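import Literature.Computability.AlgebraicComplexity.TokenExpansionAdd
import HarnessLib

/-!
# The token expansion of a normalized circuit, IV: Boolean leaves; the theorem

The step at a Boolean leaf `k < u`: its clones carry the chain variables `a_{k,c}` with the
factors `[a_{k,0} = ¬s_0]`, `[a_{k,c+1} = a_{k,c} ∧ ¬s_{c+1}]` and the chain end `1 + [a_{k,D-1}]`,
so the only non-vanishing extension is `a_{k,c} = ∧_{i ≤ c} ¬ s_i` (`βevar`, `chain_forced`) with
node product `1 + [no clone of k demanded]`; on the other side `RHS_{k+1}` splits along `e_k`
(`RHS_evar`): the factor `(val_e k)^{#demanded} = [e_k]^{#demanded}` kills the points with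
`e_k = 0` unless nothing is demanded, the points with `e_k = 1` contribute the same as their
toggles (values below `k` do not depend on `e_k`, `val_congr_below`), whence the same factor
`1 + [no clone of k demanded]`.
Then the base `W_0 = 1 = RHS_0`, the induction `W_eq_RHS`, and the root factor `[t₀]` give

* `NCirc.sum_prod_factors` — **the token expansion theorem**
  `∑_b ∏_f F f b = ∑_{e : Fin u → Bool} val e (m - 1)`.

## References

* G. Malod, N. Portier, *Characterizing Valiant's algebraic complexity classes*, J. Complexity
  24 (2008) 16–38: Lemma 2 (reduced circuits) and Thm. 2 with its proof (the local conditions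
  (1)–(4) of a parse tree, pp. 8–9 of the MFCS 2006 version).
* P. Bürgisser, *On defining integers and proving arithmetic circuit lower bounds*,
  Comput. Complexity 18 (2009) 81–103, Thm. 2.10 (ECCC TR06-113, p. 8).
-/

namespace Literature.Computability.AlgebraicComplexity

open Finset

universe u

namespace NCirc

variable {R : Type u} [CommRing R] (N : NCirc R) (D : ℕ) (hD : 1 ≤ D) (hm : 0 < N.m)

/-! ### The step at a Boolean leaf -/

section StepEvar

variable {k : ℕ}

/-- Values below `n` only depend on the Boolean point below `n`. [folklore] -/
theorem val_congr_below (e e' : ℕ → Bool) (n : ℕ) (h : ∀ j < n, e j = e' j) :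
    ∀ i < n, i < N.m → N.val e i = N.val e' i := by
  intro i
  induction i using Nat.strong_induction_on with
  | _ i ih =>
    intro hin him
    rw [N.val_eq e i him, N.val_eq e' i him]
    have hw := N.wf i him
    cases hk : N.kind i with
    | leaf ℓ => rfl
    | evar => simp [NK.eval, h i hin]
    | mul a b =>
      rw [hk] at hw
      have ha : a < i := hw a (by simp [NK.children])
      have hb : b < i := hw b (by simp [NK.children])
      simp only [NK.eval]
      rw [ih a ha (by omega) (by omega), ih b hb (by omega) (by omega)]
    | add a b =>
      rw [hk] at hw
      have ha : a < i := hw a (by simp [NK.children])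
      have hb : b < i := hw b (by simp [NK.children])
      simp only [NK.eval]
      rw [ih a ha (by omega) (by omega), ih b hb (by omega) (by omega)]
    | pass c a =>
      rw [hk] at hw
      have ha : a < i := hw a (by simp [NK.children])
      simp only [NK.eval]
      rw [ih a ha (by omega) (by omega)]

/-- A variable with source `k < u` is a chain variable of the Boolean leaf `k`. [folklore] -/
theorem exists_aux_of_src (hku : k < N.u) (v : N.Var D) (hs : N.src D v = k) :
    ∃ q : N.Aux D, v = Sum.inr (Sum.inr q) ∧ q.1.1 = ⟨k, hku⟩ := by
  rcases v with τ | ⟨⟨⟩⟩ | q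
  · exfalso
    simp only [src] at hs
    have h1 := τ.2.2
    have h2 : N.kind τ.1.1.1.val = NK.evar := (N.kind_evar _ τ.1.1.1.isLt).2 (by omega)
    rw [h2] at h1
    exact Nat.not_lt_zero _ h1
  · simp [src] at hs
    have := N.u_le
    omega
  · exact ⟨q, rfl, Fin.ext hs⟩

/-- At a Boolean leaf there are no new out-tokens. [folklore] -/
theorem newOut_eq_empty_evar (hku : k < N.u) (γ : N.Var D → Bool) : N.newOut D k γ = ∅ := by
  ext v
  unfold newOut
  simp only [Finset.mem_filter, Finset.mem_univ, true_and, Finset.notMem_empty, iff_false, not_and]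
  intro _ hs
  obtain ⟨q, rfl, -⟩ := N.exists_aux_of_src D hku v hs
  simp [tgtV]

/-- Any extension at a Boolean leaf is a valid demand across the cut `k`. [folklore] -/
theorem valid_of_ext_evar (hk : k < N.m) (hku : k < N.u) (β : N.Var D → Bool) (hval : N.Valid D (k + 1) β)
    (γ : N.Var D → Bool) (hγ : γ ∈ N.Ext D k β) : N.Valid D k γ := by
  intro v hv w hw hne
  rw [N.dem_of_ext D hk β _ hγ, N.newOut_eq_empty_evar D hku, Finset.union_empty] at hv hw
  exact hval v (Finset.mem_filter.1 hv).1 w (Finset.mem_filter.1 hw).1 hne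

/-- No clone of `k` is demanded up to the offset `c`. [folklore] -/
noncomputable def noDem (hk : k < N.m) (β : N.Var D → Bool) (c : ℕ) : Bool :=
  decide (∀ i : Fin (D + 1), i.val ≤ c → N.sdem D hk β i = false)

/-- The chain recursion of `noDem`. [folklore] -/
theorem noDem_zero (hk : k < N.m) (β : N.Var D → Bool) : N.noDem D hk β 0 = !N.sdem D hk β 0 := by
  unfold noDem
  by_cases h : N.sdem D hk β 0 = true
  · rw [h]
    simp only [Bool.not_true, decide_eq_false_iff_not, not_forall]
    exact ⟨0, le_rfl, by simp [h]⟩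
  · have h' : N.sdem D hk β 0 = false := by simpa using h
    rw [h']
    simp only [Bool.not_false, decide_eq_true_eq]
    intro i hi
    have : i = 0 := Fin.ext (by simpa using hi)
    subst this
    exact h'

/-- The chain recursion of `noDem` (successor). [folklore] -/
theorem noDem_succ (hk : k < N.m) (β : N.Var D → Bool) (c : ℕ) (hc : c + 1 < D + 1) :
    N.noDem D hk β (c + 1) = (N.noDem D hk β c && !N.sdem D hk β ⟨c + 1, hc⟩) := by
  unfold noDem
  rw [Bool.eq_iff_iff]
  simp only [decide_eq_true_eq, Bool.and_eq_true, Bool.not_eq_true']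
  constructor
  · intro h
    exact ⟨fun i hi => h i (by omega), h _ le_rfl⟩
  · rintro ⟨h1, h2⟩ i hi
    rcases Nat.lt_or_ge i.val (c + 1) with hlt | hge
    · exact h1 i (by omega)
    · have : i = ⟨c + 1, hc⟩ := Fin.ext (by simp; omega)
      subst this
      exact h2

/-- **The consistent extension at a Boolean leaf**: `a_{k,c} = ∧_{i ≤ c} ¬ s_i`. [folklore] -/
noncomputable def βevar (hk : k < N.m) (β : N.Var D → Bool) : N.Var D → Bool := fun v =>
  match v with
  | Sum.inl τ => if k < N.src D (Sum.inl τ) then β (Sum.inl τ) else false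
  | Sum.inr (Sum.inl z) => if k < N.src D (Sum.inr (Sum.inl z)) then β (Sum.inr (Sum.inl z)) else false
  | Sum.inr (Sum.inr q) => if q.1.1.val = k then N.noDem D hk β q.1.2.val
      else if k < q.1.1.val then β (Sum.inr (Sum.inr q)) else false

/-- `βevar` agrees with `β` above `k`. [folklore] -/
theorem βevar_above (hk : k < N.m) (β : N.Var D → Bool) (v : N.Var D) (hv : k < N.src D v) :
    N.βevar D hk β v = β v := by
  rcases v with τ | z | q
  · simp only [βevar]; rw [if_pos hv]
  · simp only [βevar]; rw [if_pos hv]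
  · simp only [src] at hv
    simp only [βevar]
    rw [if_neg (by omega), if_pos hv]

/-- `βevar` vanishes below `k`. [folklore] -/
theorem βevar_below (hk : k < N.m) (β : N.Var D → Bool) (v : N.Var D) (hv : N.src D v < k) :
    N.βevar D hk β v = false := by
  rcases v with τ | z | q
  · simp only [βevar]; rw [if_neg (by omega)]
  · simp only [βevar]; rw [if_neg (by omega)]
  · simp only [src] at hv
    simp only [βevar]
    rw [if_neg (by omega), if_neg (by omega)]

/-- `βevar` on the chain variables of `k`. [folklore] -/
theorem βevar_aux (hk : k < N.m) (hku : k < N.u) (β : N.Var D → Bool) (c : Fin (D + 1)) (hc : c.val + 1 ≤ D) :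
    N.βevar D hk β (N.auxVar D ⟨k, hku⟩ c hc) = N.noDem D hk β c.val := by
  simp [βevar, auxVar]

/-- `βevar ∈ Ext_k β`. [folklore] -/
theorem βevar_mem_Ext (hk : k < N.m) (β : N.Var D → Bool) : N.βevar D hk β ∈ N.Ext D k β := by
  unfold Ext
  rw [Finset.mem_filter]
  exact ⟨Finset.mem_univ _, fun v hv => N.βevar_above D hk β v (by omega), N.βevar_below D hk β⟩

/-- The value of the clone factor `(k, 0)` of a Boolean leaf. [folklore] -/
theorem spec_cl_evar_zero (hk : k < N.m) (hku : k < N.u) (hD1 : 1 ≤ D) (h0 : 0 < D + 1) (b' : N.Var D → Bool) :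
    (N.cloneKind D (N.cl D hk ⟨0, h0⟩)).spec b' =
      if b' (N.auxVar D ⟨k, hku⟩ ⟨0, h0⟩ (by simp only; omega)) = !(N.ins D (N.cl D hk ⟨0, h0⟩)).any b'
      then 1 else 0 := by
  have hkind : N.kind (N.cl D hk ⟨0, h0⟩).1.val = NK.evar := (N.kind_evar k hk).2 hku
  have hv : N.CValid D (N.cl D hk ⟨0, h0⟩) := by
    unfold CValid cl
    have h := N.fd_eq k hk
    rw [(N.kind_evar k hk).2 hku] at h
    simp only [NK.fdeg] at h
    simp only [h]
    omega
  rw [N.cloneKind_eq D _ hv hkind]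
  rfl

/-- The value of the clone factor `(k, c+1)` of a Boolean leaf. [folklore] -/
theorem spec_cl_evar_succ (hk : k < N.m) (hku : k < N.u) (c : ℕ) (hc : c + 1 + 1 ≤ D) (b' : N.Var D → Bool) :
    (N.cloneKind D (N.cl D hk ⟨c + 1, by omega⟩)).spec b' =
      if b' (N.auxVar D ⟨k, hku⟩ ⟨c + 1, by omega⟩ hc) =
          (b' (N.auxVar D ⟨k, hku⟩ ⟨c, by omega⟩ (by simp only; omega)) &&
            !(N.ins D (N.cl D hk ⟨c + 1, by omega⟩)).any b')
      then 1 else 0 := by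
  have hkind : N.kind (N.cl D hk ⟨c + 1, by omega⟩).1.val = NK.evar := (N.kind_evar k hk).2 hku
  have hv : N.CValid D (N.cl D hk ⟨c + 1, by omega⟩) := by
    unfold CValid cl
    have h := N.fd_eq k hk
    rw [(N.kind_evar k hk).2 hku] at h
    simp only [NK.fdeg] at h
    simp only [h]
    exact hc
  rw [N.cloneKind_eq D _ hv hkind]
  rfl

/-- A demanded clone of a Boolean leaf has offset `≤ D - 1`. [folklore] -/
theorem sdem_le (hk : k < N.m) (hku : k < N.u) (hm' : 0 < N.m) (hroot : N.fd (N.m - 1) ≤ D)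
    (β : N.Var D → Bool) (c : Fin (D + 1)) (hc : N.sdem D hk β c = true) : c.val + 1 ≤ D := by
  have hv := N.cvalid_of_sdem D hk hm' hroot β c hc
  unfold CValid cl at hv
  have h := N.fd_eq k hk
  rw [(N.kind_evar k hk).2 hku] at h
  simp only [NK.fdeg] at h
  simp only [h] at hv
  exact hv

end StepEvar

section StepEvar2

variable {k : ℕ}

/-- The chain-end factor takes its specified value `1 + [a_{k,D-1}]` everywhere. [folklore] -/
theorem F_fin_eq (hku : k < N.u) (hm' : 0 < N.m) (hroot : N.fd (N.m - 1) ≤ D)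
    (F : Fin (N.mF D) → (N.Var D → Bool) → R) (hF : (N.FS D hD hm' hroot).Admissible F)
    (b' : N.Var D → Bool) :
    F (N.enc D (Sum.inr (Sum.inr ⟨k, hku⟩))) b' =
      if b' (N.auxVar D ⟨k, hku⟩ ⟨D - 1, by omega⟩ (by simp only; omega)) then 2 else 1 := by
  have h := hF.2 (N.enc D (Sum.inr (Sum.inr ⟨k, hku⟩))) b'
  simp only [FS, kindF_enc, kindΦ_fin] at h
  exact h (by simp [FKind.Care, FKind.ins])

/-- The previous chain variable's value (`true` before the first one). [folklore] -/
def prevVal (hku : k < N.u) (b' : N.Var D → Bool) : ℕ → Bool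
  | 0 => true
  | c + 1 => if h : c + 1 ≤ D then b' (N.auxVar D ⟨k, hku⟩ ⟨c, by omega⟩ (by simp only; omega)) else true

/-- `prevVal` at a successor. [folklore] -/
theorem prevVal_succ (hku : k < N.u) (b' : N.Var D → Bool) (c : ℕ) (hc : c + 1 ≤ D) :
    N.prevVal D hku b' (c + 1) = b' (N.auxVar D ⟨k, hku⟩ ⟨c, by omega⟩ (by simp only; omega)) := by
  simp only [prevVal]
  rw [dif_pos hc]

/-- The clone factors of a Boolean leaf at an extension `b'`: value `[chain equation holds]` at
a valid offset, `1` at the invalid offset `D`. [folklore] -/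
theorem F_cl_evar (hk : k < N.m) (hku : k < N.u) (hm' : 0 < N.m) (hroot : N.fd (N.m - 1) ≤ D)
    (F : Fin (N.mF D) → (N.Var D → Bool) → R) (hF : (N.FS D hD hm' hroot).Admissible F)
    (β : N.Var D → Bool) (hval : N.Valid D (k + 1) β) (b' : N.Var D → Bool)
    (hb : ∀ v, k < N.src D v → b' v = β v) (c : Fin (D + 1)) :
    F (N.enc D (Sum.inl (N.cl D hk c))) b' =
      if h : c.val + 1 ≤ D then
        (if b' (N.auxVar D ⟨k, hku⟩ c h) = (N.prevVal D hku b' c.val && !N.sdem D hk β c) then 1 else 0)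
      else 1 := by
  rw [N.F_cl_eq_spec D hD hm' hk hroot F hF β hval b' hb]
  by_cases h : c.val + 1 ≤ D
  · rw [dif_pos h]
    obtain ⟨cv, hcv⟩ := c
    cases cv with
    | zero =>
      rw [N.spec_cl_evar_zero D hk hku (by omega) hcv, N.any_ins_congr D hk β b' hb]
      simp [prevVal]
    | succ c =>
      rw [N.spec_cl_evar_succ D hk hku c h, N.any_ins_congr D hk β b' hb]
      simp only [N.prevVal_succ D hku b' c (by simp only at h; omega)]
  · rw [dif_neg h]
    have hv : ¬ N.CValid D (N.cl D hk c) := by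
      unfold CValid cl
      have h' := N.fd_eq k hk
      rw [(N.kind_evar k hk).2 hku] at h'
      simp only [NK.fdeg] at h'
      simp only [h']
      exact h
    rw [N.cloneKind_of_not D _ hv]
    simp [FKind.spec]

/-- The consistent chain values satisfy the chain equations. [folklore] -/
theorem noDem_eq (hk : k < N.m) (hku : k < N.u) (β : N.Var D → Bool) (c : Fin (D + 1)) (h : c.val + 1 ≤ D) :
    N.noDem D hk β c.val = (N.prevVal D hku (N.βevar D hk β) c.val && !N.sdem D hk β c) := by
  obtain ⟨cv, hcv⟩ := c
  cases cv with
  | zero => simpa [prevVal] using N.noDem_zero D hk β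
  | succ c =>
    rw [N.prevVal_succ D hku _ c (by simp only at h; omega), N.βevar_aux D hk hku, N.noDem_succ D hk β c hcv]

/-- **`prodAt` of the consistent extension at a Boolean leaf**: `2` if no clone of `k` is
demanded, `1` otherwise (the chain end reads `a_{k,D-1} = [no demand]`). [folklore] -/
theorem prodAt_βevar (hk : k < N.m) (hku : k < N.u) (hm' : 0 < N.m) (hroot : N.fd (N.m - 1) ≤ D)
    (F : Fin (N.mF D) → (N.Var D → Bool) → R) (hF : (N.FS D hD hm' hroot).Admissible F)
    (β : N.Var D → Bool) (hval : N.Valid D (k + 1) β) :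
    N.prodAt D F k (N.βevar D hk β) = if N.noDem D hk β (D - 1) then 2 else 1 := by
  rw [N.prodAt_eq_evar D hku, N.F_fin_eq D hD hku hm' hroot F hF, N.βevar_aux D hk hku,
    Finset.prod_eq_one, mul_one]
  intro c _
  rw [N.F_cl_evar D hD hk hku hm' hroot F hF β hval _ (fun v hv => N.βevar_above D hk β v hv) c]
  by_cases h : c.val + 1 ≤ D
  · rw [dif_pos h, N.βevar_aux D hk hku, ← N.noDem_eq D hk hku β c h, if_pos rfl]
  · rw [dif_neg h]

/-- A non-vanishing node product forces the chain values. [folklore] -/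
theorem chain_forced (hk : k < N.m) (hku : k < N.u) (hm' : 0 < N.m) (hroot : N.fd (N.m - 1) ≤ D)
    (F : Fin (N.mF D) → (N.Var D → Bool) → R) (hF : (N.FS D hD hm' hroot).Admissible F)
    (β : N.Var D → Bool) (hval : N.Valid D (k + 1) β) (β' : N.Var D → Bool)
    (hb' : ∀ v, k < N.src D v → β' v = β v)
    (hfac : ∀ c : Fin (D + 1), F (N.enc D (Sum.inl (N.cl D hk c))) β' ≠ 0) :
    ∀ (c : ℕ) (hc : c + 1 ≤ D), β' (N.auxVar D ⟨k, hku⟩ ⟨c, by omega⟩ hc) = N.noDem D hk β c := by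
  intro c
  induction c with
  | zero =>
    intro hc
    have h := hfac ⟨0, by omega⟩
    rw [N.F_cl_evar D hD hk hku hm' hroot F hF β hval β' hb', dif_pos hc] at h
    have h' : β' (N.auxVar D ⟨k, hku⟩ ⟨0, by omega⟩ hc) =
        (N.prevVal D hku β' 0 && !N.sdem D hk β ⟨0, by omega⟩) := by
      by_contra hne
      exact h (if_neg hne)
    rw [h', N.noDem_zero]
    simp [prevVal]
  | succ c ih =>
    intro hc
    have h := hfac ⟨c + 1, by omega⟩
    rw [N.F_cl_evar D hD hk hku hm' hroot F hF β hval β' hb', dif_pos hc] at h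
    have h' : β' (N.auxVar D ⟨k, hku⟩ ⟨c + 1, by omega⟩ hc) =
        (N.prevVal D hku β' (c + 1) && !N.sdem D hk β ⟨c + 1, by omega⟩) := by
      by_contra hne
      exact h (if_neg hne)
    rw [h', N.noDem_succ D hk β c (by omega), N.prevVal_succ D hku β' c (by omega), ih (by omega)]

/-- **Every other extension kills a chain factor.** [folklore] -/
theorem prodAt_eq_zero_of_ne_evar (hk : k < N.m) (hku : k < N.u) (hm' : 0 < N.m)
    (hroot : N.fd (N.m - 1) ≤ D) (F : Fin (N.mF D) → (N.Var D → Bool) → R)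
    (hF : (N.FS D hD hm' hroot).Admissible F) (β : N.Var D → Bool) (hval : N.Valid D (k + 1) β)
    (β' : N.Var D → Bool) (hβ' : β' ∈ N.Ext D k β) (hne : β' ≠ N.βevar D hk β) :
    N.prodAt D F k β' = 0 := by
  have hb' := N.agree_of_mem_Ext D β β' hβ'
  by_contra hne0
  rw [N.prodAt_eq_evar D hku] at hne0
  have hfac : ∀ c : Fin (D + 1), F (N.enc D (Sum.inl (N.cl D hk c))) β' ≠ 0 :=
    fun c h0 => hne0 (by rw [Finset.prod_eq_zero (Finset.mem_univ c) h0, mul_zero])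
  have hchain := N.chain_forced D hD hk hku hm' hroot F hF β hval β' hb' hfac
  apply hne
  funext v
  by_cases hs : N.src D v = k
  · obtain ⟨q, rfl, hq⟩ := N.exists_aux_of_src D hku v hs
    obtain ⟨⟨q1, ⟨c, hc⟩⟩, hq2⟩ := q
    simp only at hq
    subst hq
    have := hchain c hq2
    simp only [auxVar] at this
    rw [this]
    simp [βevar]
  · unfold Ext at hβ'
    rw [Finset.mem_filter] at hβ'
    rcases Nat.lt_or_gt_of_ne hs with hlt | hgt
    · rw [hβ'.2.2 v hlt, N.βevar_below D hk β v hlt]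
    · rw [hb' v hgt, N.βevar_above D hk β v hgt]

end StepEvar2

section StepEvar3

variable {k : ℕ}

/-- The value of a Boolean leaf. [folklore] -/
theorem val_evar (hk : k < N.m) (hku : k < N.u) (e : Fin N.u → Bool) :
    N.val (N.ext e) k = if e ⟨k, hku⟩ then 1 else 0 := by
  rw [N.val_eq (N.ext e) k hk, (N.kind_evar k hk).2 hku]
  simp [NK.eval, ext, hku]

/-- `noDem (D-1)` says that no clone of `k` is demanded at all. [folklore] -/
theorem noDem_iff (hk : k < N.m) (hku : k < N.u) (hm' : 0 < N.m) (hroot : N.fd (N.m - 1) ≤ D) (hD1 : 1 ≤ D)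
    (β : N.Var D → Bool) : N.noDem D hk β (D - 1) = true ↔ N.Sdem D hk β = ∅ := by
  unfold noDem
  rw [decide_eq_true_eq, Finset.eq_empty_iff_forall_notMem]
  constructor
  · intro h c hc
    rw [N.mem_Sdem] at hc
    have := N.sdem_le D hk hku hm' hroot β c hc
    rw [h c (by omega)] at hc
    exact Bool.false_ne_true hc
  · intro h c _
    by_contra hc
    exact h c ((N.mem_Sdem D hk β c).2 (by simpa using hc))

/-- `Rep_k` inside `Rep_{k+1}`: the points with `e_k = false`. [folklore] -/
theorem Rep_eq_filter (hku : k < N.u) :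
    N.Rep k = (N.Rep (k + 1)).filter fun e => e ⟨k, hku⟩ = false := by
  ext e
  unfold Rep
  simp only [Finset.mem_filter, Finset.mem_univ, true_and]
  constructor
  · intro h
    exact ⟨fun j hj => h j (by omega), h _ le_rfl⟩
  · rintro ⟨h1, h2⟩ j hj
    rcases Nat.lt_or_ge j.val (k + 1) with hlt | hge
    · have : j = ⟨k, hku⟩ := Fin.ext (by simp; omega)
      subst this
      exact h2
    · exact h1 j hge

/-- Toggling `e_k` maps `Rep_k` onto the points of `Rep_{k+1}` with `e_k = true`. [folklore] -/
theorem sum_Rep_true (hku : k < N.u) (g : (Fin N.u → Bool) → R) :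
    ∑ e ∈ (N.Rep (k + 1)).filter (fun e => e ⟨k, hku⟩ = true), g e =
      ∑ e ∈ N.Rep k, g (Function.update e ⟨k, hku⟩ true) := by
  refine Finset.sum_nbij' (fun e => Function.update e ⟨k, hku⟩ false)
    (fun e => Function.update e ⟨k, hku⟩ true) ?_ ?_ ?_ ?_ ?_
  · intro e he
    rw [Finset.mem_filter] at he
    unfold Rep at he ⊢
    rw [Finset.mem_filter] at he ⊢
    refine ⟨Finset.mem_univ _, fun j hj => ?_⟩
    by_cases hjk : j = ⟨k, hku⟩
    · subst hjk; simp
    · rw [Function.update_of_ne hjk]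
      exact he.1.2 j (by have : j.val ≠ k := fun h => hjk (Fin.ext h); omega)
  · intro e he
    rw [Finset.mem_filter]
    unfold Rep at he ⊢
    rw [Finset.mem_filter] at he ⊢
    refine ⟨⟨Finset.mem_univ _, fun j hj => ?_⟩, by simp⟩
    have hjk : j ≠ ⟨k, hku⟩ := fun h => by subst h; simp at hj
    rw [Function.update_of_ne hjk]
    exact he.2 j (by omega)
  · intro e he
    rw [Finset.mem_filter] at he
    funext j
    by_cases hjk : j = ⟨k, hku⟩
    · subst hjk; simp [he.2]
    · simp [Function.update_of_ne hjk]
  · intro e he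
    unfold Rep at he
    rw [Finset.mem_filter] at he
    funext j
    by_cases hjk : j = ⟨k, hku⟩
    · subst hjk; simp [he.2 ⟨k, hku⟩ le_rfl]
    · simp [Function.update_of_ne hjk]
  · intro e he
    rw [Finset.mem_filter] at he
    congr 1
    funext j
    by_cases hjk : j = ⟨k, hku⟩
    · subst hjk; simp [he.2]
    · simp [Function.update_of_ne hjk]

/-- **`RHS` at a Boolean leaf**: `(1 + [no clone of k demanded]) · RHS_k(βevar) = RHS_{k+1}(β)`,
by splitting `Rep_{k+1}` along `e_k`. [folklore] -/
theorem RHS_evar (hk : k < N.m) (hku : k < N.u) (hm' : 0 < N.m) (hroot : N.fd (N.m - 1) ≤ D) (hD1 : 1 ≤ D)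
    (β : N.Var D → Bool) (hval : N.Valid D (k + 1) β) :
    (if N.noDem D hk β (D - 1) then 2 else 1 : R) * N.RHS D k (N.βevar D hk β) = N.RHS D (k + 1) β := by
  -- the left-hand side
  have hL : N.RHS D k (N.βevar D hk β) =
      ∑ e ∈ N.Rep k, ∏ v ∈ N.demLow D k β, N.val (N.ext e) (N.tgtN D v).1 := by
    unfold RHS
    refine Finset.sum_congr rfl fun e _ => ?_
    rw [N.dem_of_ext D hk β _ (N.βevar_mem_Ext D hk β), N.newOut_eq_empty_evar D hku, Finset.union_empty]
  set S := ∑ e ∈ N.Rep k, ∏ v ∈ N.demLow D k β, N.val (N.ext e) (N.tgtN D v).1 with hS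
  -- the right-hand side
  rw [hL, N.RHS_succ_eq D k β, ← Finset.sum_filter_add_sum_filter_not (N.Rep (k + 1))
    (fun e => e ⟨k, hku⟩ = false), ← N.Rep_eq_filter hku]
  have h1 : ∑ e ∈ N.Rep k, (∏ v ∈ N.demLow D k β, N.val (N.ext e) (N.tgtN D v).1) *
      N.val (N.ext e) k ^ (N.demAt D k β).card =
      if (N.demAt D k β).card = 0 then S else 0 := by
    have : ∀ e ∈ N.Rep k, (∏ v ∈ N.demLow D k β, N.val (N.ext e) (N.tgtN D v).1) *
        N.val (N.ext e) k ^ (N.demAt D k β).card =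
        (∏ v ∈ N.demLow D k β, N.val (N.ext e) (N.tgtN D v).1) *
          (if (N.demAt D k β).card = 0 then 1 else 0) := by
      intro e he
      unfold Rep at he
      rw [Finset.mem_filter] at he
      rw [N.val_evar hk hku, he.2 ⟨k, hku⟩ le_rfl]
      simp [zero_pow_eq]
    rw [Finset.sum_congr rfl this, ← Finset.sum_mul]
    split_ifs <;> simp [hS]
  have h2 : ∑ e ∈ (N.Rep (k + 1)).filter (fun e => ¬ e ⟨k, hku⟩ = false),
      (∏ v ∈ N.demLow D k β, N.val (N.ext e) (N.tgtN D v).1) * N.val (N.ext e) k ^ (N.demAt D k β).card = S := by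
    have hf : (N.Rep (k + 1)).filter (fun e => ¬ e ⟨k, hku⟩ = false) =
        (N.Rep (k + 1)).filter (fun e => e ⟨k, hku⟩ = true) := by
      congr 1; ext e; simp
    rw [hf, N.sum_Rep_true hku]
    refine Finset.sum_congr rfl fun e _ => ?_
    rw [N.val_evar hk hku]
    simp only [Function.update_self, if_true, one_pow, mul_one]
    refine Finset.prod_congr rfl fun v hv => ?_
    have hlt := (Finset.mem_filter.1 hv).2
    refine N.val_congr_below _ _ k (fun j hj => ?_) _ hlt (by omega)
    unfold ext
    by_cases hju : j < N.u
    · rw [dif_pos hju, dif_pos hju, Function.update_of_ne]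
      exact fun h => by simp [Fin.ext_iff] at h; omega
    · rw [dif_neg hju, dif_neg hju]
  rw [h1, h2, N.card_demAt_eq D hk β hval]
  have h3 : ((N.Sdem D hk β).card = 0) ↔ N.noDem D hk β (D - 1) = true := by
    rw [N.noDem_iff D hk hku hm' hroot hD1, Finset.card_eq_zero]
  unfold Sdem at h3
  by_cases h : N.noDem D hk β (D - 1) = true
  · rw [if_pos h, if_pos (h3.2 h)]; ring
  · rw [if_neg h, if_neg (fun h' => h (h3.1 h'))]; ring

/-- **The step of the cut induction at a Boolean leaf.** [cite: MalodPortier2008, Thm. 2] -/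
theorem step_evar (hk : k < N.m) (hku : k < N.u) (hm' : 0 < N.m) (hroot : N.fd (N.m - 1) ≤ D)
    (F : Fin (N.mF D) → (N.Var D → Bool) → R) (hF : (N.FS D hD hm' hroot).Admissible F)
    (β : N.Var D → Bool) (hval : N.Valid D (k + 1) β)
    (IH : ∀ β', N.Valid D k β' → N.W D F k β' = N.RHS D k β') :
    N.W D F (k + 1) β = N.RHS D (k + 1) β := by
  rw [N.W_succ D hD F hF.1 k β, Finset.sum_eq_single_of_mem (N.βevar D hk β) (N.βevar_mem_Ext D hk β)
    (fun β' hβ' hne => by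
      rw [N.prodAt_eq_zero_of_ne_evar D hD hk hku hm' hroot F hF β hval β' hβ' hne, zero_mul]),
    N.prodAt_βevar D hD hk hku hm' hroot F hF β hval,
    IH _ (N.valid_of_ext_evar D hk hku β hval _ (N.βevar_mem_Ext D hk β)),
    N.RHS_evar D hk hku hm' hroot hD β hval]

end StepEvar3

/-! ### The cut induction and the token expansion theorem -/

section Main

/-- **Base of the cut induction**: `W_0(β) = 1 = RHS_0(β)`. [folklore] -/
theorem W_zero (F : Fin (N.mF D) → (N.Var D → Bool) → R) (β : N.Var D → Bool) :
    N.W D F 0 β = N.RHS D 0 β := by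
  have hW : N.W D F 0 β = 1 := by
    unfold W
    rw [Finset.sum_eq_single_of_mem β (by simp [Agree])]
    · unfold prodBelow
      rw [Finset.prod_eq_one]
      intro x hx
      simp at hx
    · intro b hb hne
      exfalso
      apply hne
      funext v
      exact (Finset.mem_filter.1 hb).2 v (Nat.zero_le _)
  have hR : N.RHS D 0 β = 1 := by
    unfold RHS
    have hdem : N.dem D 0 β = ∅ := by
      ext v
      rw [N.mem_dem]
      simp
    rw [hdem]
    simp only [Finset.prod_empty]
    rw [Finset.sum_const, nsmul_eq_mul, mul_one]
    have : N.Rep 0 = {fun _ => false} := by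
      ext e
      unfold Rep
      simp only [Finset.mem_filter, Finset.mem_univ, true_and, Nat.zero_le, forall_const,
        Finset.mem_singleton]
      constructor
      · intro h; funext j; exact h j
      · rintro rfl j; rfl
    rw [this, Finset.card_singleton, Nat.cast_one]
  rw [hW, hR]

/-- **The cut induction** (Malod–Portier 2008, proof of Thm. 2, in token form): for every valid
demand `β` across the cut `k ≤ m`, `W_k(β) = ∑_{e ∈ Rep_k} ∏_{v ∈ dem_k β} val_e(target of v)`. [cite: MalodPortier2008, Thm. 2] -/
theorem W_eq_RHS (hm' : 0 < N.m) (hroot : N.fd (N.m - 1) ≤ D)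
    (F : Fin (N.mF D) → (N.Var D → Bool) → R) (hF : (N.FS D hD hm' hroot).Admissible F) :
    ∀ k, k ≤ N.m → ∀ β, N.Valid D k β → N.W D F k β = N.RHS D k β := by
  intro k
  induction k with
  | zero => exact fun _ β _ => N.W_zero D F β
  | succ k ih =>
    intro hk β hval
    have hk' : k < N.m := hk
    have IH := ih hk'.le
    by_cases hku : k < N.u
    · exact N.step_evar D hD hk' hku hm' hroot F hF β hval IH
    · have hku' : N.u ≤ k := le_of_not_gt hku
      cases hkind : N.kind k with
      | evar => exact absurd ((N.kind_evar k hk').1 hkind) hku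
      | leaf ℓ => exact N.step_leaf D hD hk' hku' hkind hm' hroot F hF β hval IH
      | mul a b => exact N.step_mul D hD hk' hku' hkind hm' hroot F hF β hval IH
      | add a b => exact N.step_add D hD hk' hku' hkind hm' hroot F hF β hval IH
      | pass c a => exact N.step_pass D hD hk' hku' hkind hm' hroot F hF β hval IH

/-- The product of all factors, reindexed by `Φ` and split off the root factor. [folklore] -/
theorem prod_factors_eq (hm' : 0 < N.m) (hroot : N.fd (N.m - 1) ≤ D)
    (F : Fin (N.mF D) → (N.Var D → Bool) → R) (hF : (N.FS D hD hm' hroot).Admissible F)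
    (b : N.Var D → Bool) :
    ∏ f : Fin (N.mF D), F f b = (if b (N.t0 D) then 1 else 0) * N.prodBelow D F N.m b := by
  rw [Fintype.prod_equiv (N.dec D) (fun f => F f b) (fun x => F (N.enc D x) b) (fun f => by simp),
    ← Finset.prod_filter_mul_prod_filter_not Finset.univ (fun x : N.Φ D => N.nodeΦ D x < N.m), mul_comm]
  congr 1
  have hf : (univ.filter fun x : N.Φ D => ¬ N.nodeΦ D x < N.m) = {Sum.inr (Sum.inl 0)} := by
    ext x
    simp only [Finset.mem_filter, Finset.mem_univ, true_and, Finset.mem_singleton, not_lt]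
    rcases x with κ | ⟨z⟩ | k
    · simp only [nodeΦ, reduceCtorEq, iff_false, not_le]
      exact κ.1.isLt
    · simp only [nodeΦ, le_refl, true_iff, Sum.inr.injEq, Sum.inl.injEq]
      exact Fin.eq_zero z
    · simp only [nodeΦ, reduceCtorEq, iff_false, not_le, Sum.inr.injEq]
      have := k.isLt; have := N.u_le; omega
  rw [hf, Finset.prod_singleton]
  have h := hF.2 (N.enc D (Sum.inr (Sum.inl 0))) b
  simp only [FS, kindF_enc, kindΦ_root] at h
  rw [h (by simp [FKind.Care, FKind.ins])]
  rfl

/-- The target of `t₀` is the root. [folklore] -/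
theorem tgtN_t0 : N.tgtN D (N.t0 D) = (N.m - 1, 0) := rfl

/-- **THE TOKEN EXPANSION THEOREM.** For a normalized circuit `N` with Boolean leaves
`e_0, …, e_{u-1}`, budget `D ≥ fd (m-1)`, `D ≥ 1`, and every admissible realisation `F` of its
factor system, `∑_{b} ∏_f F f b = ∑_{e ∈ {0,1}^u} val_e (m - 1)`: the Boolean sum of the circuit's
output over its Boolean leaves (Malod–Portier 2008, Thm. 2, `VNP ⊆ VNP_e` by parse trees; here
with every Boolean variable read exactly twice). [cite: MalodPortier2008, Thm. 2] -/
theorem sum_prod_factors (hm' : 0 < N.m) (hroot : N.fd (N.m - 1) ≤ D)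
    (F : Fin (N.mF D) → (N.Var D → Bool) → R) (hF : (N.FS D hD hm' hroot).Admissible F) :
    ∑ b : N.Var D → Bool, ∏ f : Fin (N.mF D), F f b = ∑ e : Fin N.u → Bool, N.val (N.ext e) (N.m - 1) := by
  -- the left-hand side is `W_m(β₁)`
  have h1 : ∑ b : N.Var D → Bool, ∏ f : Fin (N.mF D), F f b = N.W D F N.m (fun _ => true) := by
    simp_rw [N.prod_factors_eq D hD hm' hroot F hF]
    unfold W
    rw [← Finset.sum_filter_add_sum_filter_not Finset.univ (fun b : N.Var D → Bool => b (N.t0 D) = true)]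
    have hz : ∑ b ∈ univ.filter (fun b : N.Var D → Bool => ¬ b (N.t0 D) = true),
        (if b (N.t0 D) then 1 else 0) * N.prodBelow D F N.m b = 0 :=
      Finset.sum_eq_zero fun b hb => by
        rw [Finset.mem_filter] at hb
        simp [hb.2]
    rw [hz, add_zero]
    have hfil : (univ.filter fun b : N.Var D → Bool => b (N.t0 D) = true) =
        univ.filter fun b => N.Agree D N.m (fun _ => true) b := by
      congr 1
      ext b
      constructor
      · intro h v hv
        rcases v with τ | ⟨⟨⟩⟩ | q
        · simp only [src] at hv; exact absurd τ.1.1.1.isLt (by omega)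
        · exact h
        · simp only [src] at hv
          have := q.1.1.isLt; have := N.u_le
          omega
      · intro h
        exact h (N.t0 D) le_rfl
    rw [hfil]
    refine Finset.sum_congr rfl fun b hb => ?_
    rw [Finset.mem_filter] at hb
    have : b (N.t0 D) = true := hb.2 (N.t0 D) le_rfl
    simp [this]
  -- the demand across the cut `m` is `{t₀}`
  have hdem : N.dem D N.m (fun _ => true) = {N.t0 D} := by
    ext v
    rw [N.mem_dem, Finset.mem_singleton]
    constructor
    · rintro ⟨-, hs, -, -⟩
      rcases v with τ | ⟨⟨⟩⟩ | q
      · simp only [src] at hs; exact absurd τ.1.1.1.isLt (by omega)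
      · rfl
      · simp only [src] at hs
        have := q.1.1.isLt; have := N.u_le
        omega
    · rintro rfl
      refine ⟨rfl, le_rfl, rfl, ?_⟩
      show N.m - 1 < N.m
      omega
  have hvalid : N.Valid D N.m (fun _ => true) := by
    intro v hv w hw hne
    rw [hdem, Finset.mem_singleton] at hv hw
    exact absurd (hv.trans hw.symm) hne
  rw [h1, N.W_eq_RHS D hD hm' hroot F hF N.m le_rfl _ hvalid]
  unfold RHS
  rw [hdem]
  have hRep : N.Rep N.m = Finset.univ := by
    unfold Rep
    ext e
    simp only [Finset.mem_filter, Finset.mem_univ, true_and, iff_true]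
    intro j hj
    have := j.isLt; have := N.u_le
    omega
  rw [hRep]
  refine Finset.sum_congr rfl fun e _ => ?_
  rw [Finset.prod_singleton, N.tgtN_t0]

end Main

end NCirc

end Literature.Computability.AlgebraicComplexity
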